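/-
Copyright (c) 2026 the pub-hodgecm-mathlib formalisation cell (harness21).  Prover seat hodgecm-mathlib-F0P3-p03 (g15): road «S3-ram» (LEAD F0P3a-plan (g12); owner
F0P3a-p06 (g15)); junction J-PACK v2 (pen F0P3a-p01 (g17), architect A-p16 (g31)), ROW-N «NILPOTENCY TOKEN FROM EIGENVALUE DEPTHS»; 2026-09-02.
-/
import Literature.NumberTheory.Automorphic.UnitaryLatticeTreeFixedChildPivotRamified    -- ★ FILE J p847433 (F0P2-p01 (g15)): `inv_mul_pow_three_mul_eq`; brings ★ FILE H p847340 `map_toLin'_latt_le_scaleLattice_iff`, `inv_mul_sq_mul_eq_sq`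
import Mathlib.LinearAlgebra.Matrix.Charpoly.Coeff                                      -- `Matrix.aeval_self_charpoly` (Cayley–Hamilton)
import HarnessLib

/-!
# The lattice graph of a hermitian space — THE NILPOTENCY TOKEN FROM THE EIGENVALUE DEPTHS: if `γ` has eigenvalues `1, λ₁, λ₂` with `|λᵢ − 1| ≤ |ϖ|^{d+1}` and `γ − 1` has
# level `ϖ^d` on a lattice `L`, then `(γ − 1)³` has level `ϖ^{3d+1}` on `L` — Cayley–Hamilton (Kottwitz 1986 §3; Rogawski 1990 §4.9)

Topic `NumberTheory/Automorphic`; namespace `Literature.NumberTheory.Automorphic.UnitaryLatticeTree`.  THEOREMS ONLY (no definition, no instance, no notation, no named fact,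
no `sorry`); kernel lane `--supports stmt-HodgeConjecture-24833`; datum-free (`K` with `Valued K ℤᵐ⁰`; any `3 × 3` matrix `γ`, no form, no `σ`).  Cell `pub/hodgecm-mathlib`
(D-0151), crux H413; road «S3-ram» (Literature seeding, count-neutral).  **ROW-N** of the junction deal sheet `F0/P3a/F0P3a-p01/g17/junction/JPACK-v2.F0P3ap01g17.md` §2 (pen
F0P3a-p01 (g17)): the junction's rows C∕R∕E∕O∕P work in the NILPOTENT REGIME at depth `d`, hypothesis `hnil : LEV₃[v](ϖ^(3d+1))` — «the residual leading matrix `Ȳ = red(ϖ^{−d}(γ−1))`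
is nilpotent, `Ȳ³ = 0`» — and THIS FILE supplies it from the EIGENVALUE DEPTHS of the literal: a torus element `γ` with characteristic polynomial `(X − 1)(X − λ₁)(X − λ₂)` (the
`u`-normalised literal `u⁻¹T = diag(α∕u, 1, γ∕u)` conjugated into the model, J-PACK v2 §0) whose two non-trivial eigenvalues are deeper than the vertex: `|λᵢ − 1| ≤ |ϖ|^{d+1}`.

THE MATHEMATICS.  Let `N = γ − 1`, `μᵢ = λᵢ − 1`.  Cayley–Hamilton for `γ` reads `N·(N − μ₁)·(N − μ₂) = 0`, i.e. **`N³ = (μ₁ + μ₂)·N² − μ₁μ₂·N`** (§1 `sub_one_pow_three_eq_of_charpoly`),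
an identity which conjugation `N ↦ G⁻¹NG` preserves.  If `G⁻¹NG` is `ϖ^d`-integral (the token `LEV[latt G](ϖ^d)` through ★ `map_toLin'_latt_le_scaleLattice_iff`) then `(G⁻¹NG)²` is
`ϖ^{2d}`-integral (§1 `v_mul_apply_le_of_forall_v_le`, ultrametric), so every entry of `(G⁻¹NG)³ = (μ₁+μ₂)(G⁻¹NG)² − μ₁μ₂(G⁻¹NG)` is `≤ max(|ϖ|^{d+1}·|ϖ|^{2d}, |ϖ|^{2d+2}·|ϖ|^{d}) ≤
|ϖ|^{3d+1}` (§2 `v_conj_sub_one_pow_three_apply_le_of_charpoly`), which is the token **`LEV₃[latt G](ϖ^(3d+1))`** (§2 `map_sub_one_pow_three_latt_le_scaleLattice_of_charpoly`, the ROW-N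
text with `G = (g : GL (Fin 3) K)`).
HONEST LABEL: HC_CM is proved only modulo the 2 remaining named inputs (hLiu418 24832, h413 24833) until rung 0 closes; nothing printed is asserted here (Cayley–Hamilton over a field
and ultrametric entry bounds); «S3-ram» has no books consequence.

* §1 `inv_mul_pow_three_mul_eq_pow` (`G⁻¹A³G = (G⁻¹AG)³`, ★ FILE J in power form), `v_mul_apply_le_of_forall_v_le` (entries of a product), `sub_one_pow_three_eq_of_charpoly` (Cayley–Hamilton in the form
  `N³ = (μ₁+μ₂)•N² − (μ₁μ₂)•N`), `conj_sub_one_pow_three_eq_of_charpoly` (the same for `G⁻¹NG`).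
* §2 **`v_conj_sub_one_pow_three_apply_le_of_charpoly`** (matrix level: `|G⁻¹NG| ≤ |ϖ|^d ⇒ |(G⁻¹NG)³| ≤ |ϖ|^{3d+1}`), **`map_sub_one_pow_three_latt_le_scaleLattice_of_charpoly`** (ROW-N:
  `LEV[latt g](ϖ^d) ⇒ LEV₃[latt g](ϖ^(3d+1))`), `…_of_isVertex` (at any vertex of any `latticeGraph σ ϖ H`), `…_antidiagonal` (the junction socket `row_N` VERBATIM).

## References
* [Kottwitz1986] R. E. Kottwitz, *Base change for unit elements of Hecke algebras*, Compositio Math. 60 (1986), §3 (levels of a torus element on fixed lattices).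
* [Rogawski1990] J. D. Rogawski, *Automorphic Representations of Unitary Groups in Three Variables*, Ann. of Math. Stud. 123 (1990), §4.9 pp. 54–56 (the nilpotent residual
  datum of a near-singular element).
* [Serre1980Trees] J.-P. Serre, *Trees* (1980), Ch. II §1.1.
-/

set_option autoImplicit false

noncomputable section

open scoped Valued WithZero Matrix MatrixGroups
open Polynomial

namespace Literature.NumberTheory.Automorphic.UnitaryLatticeTree

open Literature.NumberTheory.Automorphic Literature.NumberTheory.Automorphic.HermitianLattice

variable {K : Type*} [Field K] [Valued K ℤᵐ⁰]

/-! ## §1 Matrix bookkeeping and Cayley–Hamilton -/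

omit [Valued K ℤᵐ⁰] in
/-- `G⁻¹A³G = (G⁻¹AG)³` for invertible `G` (★ FILE J `inv_mul_pow_three_mul_eq`, in power form). [cite: Serre1980Trees, II.1.1] -/
theorem inv_mul_pow_three_mul_eq_pow {N : ℕ} (A : Matrix (Fin N) (Fin N) K) {G : Matrix (Fin N) (Fin N) K} (hG : IsUnit G.det) :
    G⁻¹ * A ^ 3 * G = (G⁻¹ * A * G) ^ 3 := by
  rw [inv_mul_pow_three_mul_eq A hG, pow_three']

/-- **Entries of a product** (ultrametric): if all entries of `A` are `≤ a` and all entries of `B` are `≤ b` then all entries of `A * B` are `≤ a * b`. [cite: Serre1980Trees, II.1.1] -/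
theorem v_mul_apply_le_of_forall_v_le {N : ℕ} {A B : Matrix (Fin N) (Fin N) K} {a b : ℤᵐ⁰} (hA : ∀ i j, Valued.v (A i j) ≤ a) (hB : ∀ i j, Valued.v (B i j) ≤ b)
    (i j : Fin N) : Valued.v ((A * B) i j) ≤ a * b := by
  rw [Matrix.mul_apply]
  refine Valuation.map_sum_le _ fun k _ => ?_
  rw [map_mul]
  exact mul_le_mul' (hA i k) (hB k j)

omit [Valued K ℤᵐ⁰] in
/-- **CAYLEY–HAMILTON FOR A SPLIT CUBIC WITH A ROOT AT `1`.**  If `γ.charpoly = (X − 1)(X − λ₁)(X − λ₂)` then, with `N = γ − 1`, `μᵢ = λᵢ − 1`: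
`N³ = (μ₁ + μ₂)•N² − (μ₁μ₂)•N`. [cite: Kottwitz1986, §3] -/
theorem sub_one_pow_three_eq_of_charpoly {γm : Matrix (Fin 3) (Fin 3) K} {lam₁ lam₂ : K} (hchar : γm.charpoly = (X - C 1) * (X - C lam₁) * (X - C lam₂)) :
    (γm - 1) ^ 3 = (lam₁ - 1 + (lam₂ - 1)) • (γm - 1) ^ 2 - ((lam₁ - 1) * (lam₂ - 1)) • (γm - 1) := by
  have hCH := Matrix.aeval_self_charpoly γm
  rw [hchar, map_mul, map_mul, map_sub, map_sub, map_sub, aeval_X, aeval_C, aeval_C, aeval_C, map_one, Algebra.algebraMap_eq_smul_one,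
    Algebra.algebraMap_eq_smul_one] at hCH
  -- `γ − λᵢ•1 = N − μᵢ•1`
  set Nm := γm - 1 with hNm
  have h1 : γm - lam₁ • (1 : Matrix (Fin 3) (Fin 3) K) = Nm - (lam₁ - 1) • 1 := by rw [hNm, sub_smul, one_smul]; abel
  have h2 : γm - lam₂ • (1 : Matrix (Fin 3) (Fin 3) K) = Nm - (lam₂ - 1) • 1 := by rw [hNm, sub_smul, one_smul]; abel
  rw [h1, h2] at hCH
  -- expand `N (N − μ₁) (N − μ₂) = N³ − (μ₁+μ₂)N² + μ₁μ₂ N` with the `μᵢ` atomic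
  generalize lam₁ - 1 = μ₁ at hCH ⊢
  generalize lam₂ - 1 = μ₂ at hCH ⊢
  have hexp : Nm * (Nm - μ₁ • (1 : Matrix (Fin 3) (Fin 3) K)) * (Nm - μ₂ • 1) = Nm ^ 3 - (μ₁ + μ₂) • Nm ^ 2 + (μ₁ * μ₂) • Nm := by
    simp only [mul_sub, sub_mul, Matrix.mul_smul, Matrix.smul_mul, Matrix.mul_one, smul_smul, add_smul, pow_succ, pow_zero, Matrix.one_mul]
    rw [mul_comm μ₂ μ₁]
    abel
  rw [hexp] at hCH
  -- solve for `N³`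
  rw [← sub_eq_zero, ← hCH]
  abel

omit [Valued K ℤᵐ⁰] in
/-- The same identity for the conjugate `G⁻¹(γ − 1)G` (conjugation is a ring homomorphism commuting with scalars). [cite: Kottwitz1986, §3] -/
theorem conj_sub_one_pow_three_eq_of_charpoly {γm : Matrix (Fin 3) (Fin 3) K} {lam₁ lam₂ : K} (hchar : γm.charpoly = (X - C 1) * (X - C lam₁) * (X - C lam₂))
    {G : Matrix (Fin 3) (Fin 3) K} (hG : IsUnit G.det) :
    (G⁻¹ * (γm - 1) * G) ^ 3 = (lam₁ - 1 + (lam₂ - 1)) • (G⁻¹ * (γm - 1) * G) ^ 2 - ((lam₁ - 1) * (lam₂ - 1)) • (G⁻¹ * (γm - 1) * G) := by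
  rw [← inv_mul_pow_three_mul_eq_pow _ hG, ← inv_mul_sq_mul_eq_sq _ hG, sub_one_pow_three_eq_of_charpoly hchar, Matrix.mul_sub, Matrix.sub_mul, Matrix.mul_smul,
    Matrix.smul_mul, Matrix.mul_smul, Matrix.smul_mul]

/-! ## §2 The token `LEV₃(ϖ^{3d+1})` from `LEV(ϖ^d)` and the eigenvalue depths -/

/-- **MATRIX LEVEL**: if `γ.charpoly = (X − 1)(X − λ₁)(X − λ₂)` with `|λᵢ − 1| ≤ |ϖ|^{d+1}` and the conjugate `N′ = G⁻¹(γ − 1)G` is `ϖ^d`-integral, then `N′³` is `ϖ^{3d+1}`-integral: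
`|(N′³) i j| ≤ |ϖ|^{3d+1}` (`N′³ = (μ₁+μ₂)N′² − μ₁μ₂N′`, `|N′²| ≤ |ϖ|^{2d}`, `|ϖ| ≤ 1`). [cite: Kottwitz1986, §3] [cite: Rogawski1990, §4.9 pp. 54–56] -/
theorem v_conj_sub_one_pow_three_apply_le_of_charpoly {ϖ : K} (hϖ1 : Valued.v ϖ ≤ 1) {γm : Matrix (Fin 3) (Fin 3) K} {lam₁ lam₂ : K}
    (hchar : γm.charpoly = (X - C 1) * (X - C lam₁) * (X - C lam₂)) {d : ℕ}
    (hlam₁ : Valued.v (lam₁ - 1) ≤ Valued.v ϖ ^ (d + 1)) (hlam₂ : Valued.v (lam₂ - 1) ≤ Valued.v ϖ ^ (d + 1))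
    {G : Matrix (Fin 3) (Fin 3) K} (hG : IsUnit G.det) (hN : ∀ i j, Valued.v ((G⁻¹ * (γm - 1) * G) i j) ≤ Valued.v ϖ ^ d) (i j : Fin 3) :
    Valued.v (((G⁻¹ * (γm - 1) * G) ^ 3 : Matrix (Fin 3) (Fin 3) K) i j) ≤ Valued.v ϖ ^ (3 * d + 1) := by
  have hpow : ∀ {m n : ℕ}, n ≤ m → Valued.v ϖ ^ m ≤ Valued.v ϖ ^ n := fun {m n} h => pow_le_pow_right_of_le_one' hϖ1 h
  set N' := G⁻¹ * (γm - 1) * G with hN'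
  have hsq : ∀ i j, Valued.v ((N' ^ 2 : Matrix (Fin 3) (Fin 3) K) i j) ≤ Valued.v ϖ ^ d * Valued.v ϖ ^ d := fun i j => by
    rw [pow_two]; exact v_mul_apply_le_of_forall_v_le hN hN i j
  rw [conj_sub_one_pow_three_eq_of_charpoly hchar hG, Matrix.sub_apply, Matrix.smul_apply, Matrix.smul_apply, smul_eq_mul, smul_eq_mul]
  refine (Valuation.map_sub _ _ _).trans (max_le ?_ ?_)
  · rw [map_mul]
    calc Valued.v (lam₁ - 1 + (lam₂ - 1)) * Valued.v ((N' ^ 2 : Matrix (Fin 3) (Fin 3) K) i j)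
        ≤ Valued.v ϖ ^ (d + 1) * (Valued.v ϖ ^ d * Valued.v ϖ ^ d) :=
          mul_le_mul' ((Valuation.map_add _ _ _).trans (max_le hlam₁ hlam₂)) (hsq i j)
      _ = Valued.v ϖ ^ (3 * d + 1) := by rw [← pow_add, ← pow_add]; congr 1; ring
  · rw [map_mul, map_mul]
    calc Valued.v (lam₁ - 1) * Valued.v (lam₂ - 1) * Valued.v (N' i j)
        ≤ Valued.v ϖ ^ (d + 1) * Valued.v ϖ ^ (d + 1) * Valued.v ϖ ^ d := mul_le_mul' (mul_le_mul' hlam₁ hlam₂) (hN i j)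
      _ = Valued.v ϖ ^ (3 * d + 2) := by rw [← pow_add, ← pow_add]; congr 1; ring
      _ ≤ Valued.v ϖ ^ (3 * d + 1) := hpow (by omega)

/-- **ROW-N «NILPOTENCY TOKEN FROM EIGENVALUE DEPTHS».**  If `γ.charpoly = (X − 1)(X − λ₁)(X − λ₂)` with `|λ₁ − 1|, |λ₂ − 1| ≤ |ϖ|^{d+1}` (`|ϖ| ≤ 1`, `ϖ ≠ 0`) and `γ − 1` has
level `ϖ^d` on the lattice `latt g` (`LEV[latt g](ϖ^d)`), then `(γ − 1)³` has level `ϖ^{3d+1}` on it (`LEV₃[latt g](ϖ^(3d+1))`): the residual leading matrix at depth `d` is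
NILPOTENT — the `hnil` of the junction's rows C∕R∕E∕O∕P. [cite: Kottwitz1986, §3] [cite: Rogawski1990, §4.9 pp. 54–56] -/
theorem map_sub_one_pow_three_latt_le_scaleLattice_of_charpoly {ϖ : K} (hϖ1 : Valued.v ϖ ≤ 1) (hϖ0 : ϖ ≠ 0) {γm : Matrix (Fin 3) (Fin 3) K} {lam₁ lam₂ : K}
    (hchar : γm.charpoly = (X - C 1) * (X - C lam₁) * (X - C lam₂)) {d : ℕ}
    (hlam₁ : Valued.v (lam₁ - 1) ≤ Valued.v ϖ ^ (d + 1)) (hlam₂ : Valued.v (lam₂ - 1) ≤ Valued.v ϖ ^ (d + 1)) (g : GL (Fin 3) K)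
    (hlev : (latt (g : Matrix (Fin 3) (Fin 3) K)).map ((Matrix.toLin' (γm - 1)).restrictScalars 𝒪[K]) ≤ scaleLattice (ϖ ^ d) (latt (g : Matrix (Fin 3) (Fin 3) K))) :
    (latt (g : Matrix (Fin 3) (Fin 3) K)).map ((Matrix.toLin' ((γm - 1) ^ 3)).restrictScalars 𝒪[K]) ≤
      scaleLattice (ϖ ^ (3 * d + 1)) (latt (g : Matrix (Fin 3) (Fin 3) K)) := by
  have hG : IsUnit (g : Matrix (Fin 3) (Fin 3) K).det := Matrix.isUnits_det_units g
  have hinv : (g : Matrix (Fin 3) (Fin 3) K)⁻¹ = ((g⁻¹ : GL (Fin 3) K) : Matrix (Fin 3) (Fin 3) K) := (Matrix.coe_units_inv g).symm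
  have hN : ∀ i j, Valued.v (((g : Matrix (Fin 3) (Fin 3) K)⁻¹ * (γm - 1) * (g : Matrix (Fin 3) (Fin 3) K)) i j) ≤ Valued.v ϖ ^ d := by
    intro i j
    have h := (map_toLin'_latt_le_scaleLattice_iff (pow_ne_zero _ hϖ0) (γm - 1) hG).1 hlev i j
    rwa [map_pow] at h
  rw [map_toLin'_latt_le_scaleLattice_iff (pow_ne_zero _ hϖ0) _ hG, inv_mul_pow_three_mul_eq_pow _ hG]
  intro i j
  rw [map_pow]
  exact v_conj_sub_one_pow_three_apply_le_of_charpoly hϖ1 hchar hlam₁ hlam₂ hG hN i j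

/-- **ROW-N at a VERTEX of any lattice graph**: the same for an arbitrary vertex `M` of `latticeGraph σ ϖ H` (a vertex is `latt g` for some `g ∈ GL₃(K)`), with the tree's
uniformiser token `|ϖ| = exp(−1)`. [cite: Kottwitz1986, §3] [cite: Rogawski1990, §4.9 pp. 54–56] -/
theorem map_sub_one_pow_three_le_scaleLattice_of_charpoly_of_isVertex {σ : K →+* K} {ϖ : K} (hϖ : Valued.v ϖ = WithZero.exp (-1 : ℤ))
    {H : Matrix (Fin 3) (Fin 3) K} {γm : Matrix (Fin 3) (Fin 3) K} {lam₁ lam₂ : K} (hchar : γm.charpoly = (X - C 1) * (X - C lam₁) * (X - C lam₂)) {d : ℕ}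
    (hlam₁ : Valued.v (lam₁ - 1) ≤ Valued.v ϖ ^ (d + 1)) (hlam₂ : Valued.v (lam₂ - 1) ≤ Valued.v ϖ ^ (d + 1))
    {M : Submodule 𝒪[K] (Fin 3 → K)} (hM : IsVertex σ ϖ H M) (hlev : M.map ((Matrix.toLin' (γm - 1)).restrictScalars 𝒪[K]) ≤ scaleLattice (ϖ ^ d) M) :
    M.map ((Matrix.toLin' ((γm - 1) ^ 3)).restrictScalars 𝒪[K]) ≤ scaleLattice (ϖ ^ (3 * d + 1)) M := by
  have hϖ0 : ϖ ≠ 0 := fun h0 => by rw [h0, map_zero] at hϖ; exact WithZero.coe_ne_zero hϖ.symm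
  have hϖ1 : Valued.v ϖ ≤ 1 := by rw [hϖ, ← WithZero.exp_zero]; exact WithZero.exp_le_exp.2 (by norm_num)
  obtain ⟨_, g, rfl, -⟩ := hM
  exact map_sub_one_pow_three_latt_le_scaleLattice_of_charpoly hϖ1 hϖ0 hchar hlam₁ hlam₂ g hlev

/-- **THE JUNCTION SOCKET `row_N` VERBATIM** (J-PACK v2 skeleton `JunctionSockets.skeleton.v2` :30, binder order and token spelling as there; the `K₀`-membership of `γ` is not
used): for `γ ∈ U(J₀)` with `charpoly = (X − 1)(X − μ₁)(X − μ₂)`, `|μᵢ − 1| ≤ |ϖ|^{d+1}`, and a vertex `w` with `LEV[w](ϖ^d)`: `LEV₃[w](ϖ^(3d+1))`.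
[cite: Kottwitz1986, §3] [cite: Rogawski1990, §4.9 pp. 54–56] -/
theorem map_sub_one_pow_three_le_scaleLattice_of_charpoly_antidiagonal {σ : K →+* K} {ϖ : K} (hϖ : Valued.v ϖ = WithZero.exp (-1 : ℤ))
    {γ : unitaryGroupOfForm σ ((StdForm.antidiagonal 3).over K)} (_hγ0 : γ ∈ unitaryInt σ ((StdForm.antidiagonal 3).over K))
    {μ₁ μ₂ : K} (hchar : (((γ : GL (Fin 3) K) : Matrix (Fin 3) (Fin 3) K)).charpoly = (X - C 1) * (X - C μ₁) * (X - C μ₂))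
    {d : ℕ} (hμ₁ : Valued.v (μ₁ - 1) ≤ Valued.v ϖ ^ (d + 1)) (hμ₂ : Valued.v (μ₂ - 1) ≤ Valued.v ϖ ^ (d + 1))
    (w : {M : Submodule 𝒪[K] (Fin 3 → K) // IsVertex σ ϖ ((StdForm.antidiagonal 3).over K) M})
    (hlev : w.1.map ((Matrix.toLin' (((γ : GL (Fin 3) K) : Matrix (Fin 3) (Fin 3) K) - 1)).restrictScalars 𝒪[K]) ≤ scaleLattice (ϖ ^ d) w.1) :
    w.1.map ((Matrix.toLin' ((((γ : GL (Fin 3) K) : Matrix (Fin 3) (Fin 3) K) - 1) ^ 3)).restrictScalars 𝒪[K]) ≤ scaleLattice (ϖ ^ (3 * d + 1)) w.1 :=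
  map_sub_one_pow_three_le_scaleLattice_of_charpoly_of_isVertex hϖ hchar hμ₁ hμ₂ w.2 hlev

/-! ## §3 The junction's literal `γ′ = A·diag(a, 1, c)·A⁻¹`: its characteristic polynomial, and ROW-N from the eigenvalue depths directly (ED. 2) -/

omit [Valued K ℤᵐ⁰] in
/-- The characteristic polynomial of a `GL₃`-conjugate of a diagonal matrix: `charpoly(A·diag(s)·A⁻¹) = Π (X − sᵢ)` (Mathlib `charpoly_units_conj` ∘ `charpoly_diagonal`),
written with the middle factor first when `s = (a, 1, c)`: `= (X − 1)(X − a)(X − c)`. [cite: Kottwitz1986, §3] -/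
theorem charpoly_coe_conj_diagonal_three (A T : GL (Fin 3) K) {a c : K} (hT : (T : Matrix (Fin 3) (Fin 3) K) = Matrix.diagonal ![a, 1, c]) :
    (((A * T * A⁻¹ : GL (Fin 3) K)) : Matrix (Fin 3) (Fin 3) K).charpoly = (X - C 1) * (X - C a) * (X - C c) := by
  rw [Units.val_mul, Units.val_mul, Matrix.coe_units_inv, Matrix.charpoly_units_conj, hT, Matrix.charpoly_diagonal, Fin.prod_univ_three]
  simp only [Matrix.cons_val_zero, Matrix.cons_val_one, Matrix.cons_val_two, Matrix.head_cons, Matrix.tail_cons]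
  ring

/-- **ROW-N FOR THE JUNCTION'S LITERAL** (J-PACK v2 §0: `γ′ := A·T″·A⁻¹`, `T″ = diag(α∕u, 1, γ∕u)`): if `T″ = diag(a, 1, c)` with `|a − 1|, |c − 1| ≤ |ϖ|^{d+1}` and `γ′ − 1` has level
`ϖ^d` at a vertex `M` of any lattice graph, then `(γ′ − 1)³` has level `ϖ^{3d+1}` there — no charpoly hypothesis left for the pen. [cite: Kottwitz1986, §3] [cite: Rogawski1990, §4.9 pp. 54–56] -/
theorem map_sub_one_pow_three_le_scaleLattice_of_conj_diagonal {σ : K →+* K} {ϖ : K} (hϖ : Valued.v ϖ = WithZero.exp (-1 : ℤ)) {H : Matrix (Fin 3) (Fin 3) K}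
    (A T : GL (Fin 3) K) {a c : K} (hT : (T : Matrix (Fin 3) (Fin 3) K) = Matrix.diagonal ![a, 1, c]) {d : ℕ}
    (ha : Valued.v (a - 1) ≤ Valued.v ϖ ^ (d + 1)) (hc : Valued.v (c - 1) ≤ Valued.v ϖ ^ (d + 1))
    {M : Submodule 𝒪[K] (Fin 3 → K)} (hM : IsVertex σ ϖ H M)
    (hlev : M.map ((Matrix.toLin' ((((A * T * A⁻¹ : GL (Fin 3) K)) : Matrix (Fin 3) (Fin 3) K) - 1)).restrictScalars 𝒪[K]) ≤ scaleLattice (ϖ ^ d) M) :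
    M.map ((Matrix.toLin' (((((A * T * A⁻¹ : GL (Fin 3) K)) : Matrix (Fin 3) (Fin 3) K) - 1) ^ 3)).restrictScalars 𝒪[K]) ≤ scaleLattice (ϖ ^ (3 * d + 1)) M :=
  map_sub_one_pow_three_le_scaleLattice_of_charpoly_of_isVertex hϖ (charpoly_coe_conj_diagonal_three A T hT) ha hc hM hlev

/-! ## §4 The type-(2) twin (ED. 3): one eigenvalue `λ ∈ K` and a QUADRATIC factor `X² − tX + n` (possibly irreducible over `K`) -/

omit [Valued K ℤᵐ⁰] in
/-- **CAYLEY–HAMILTON FOR A CUBIC WITH ONE RATIONAL ROOT AND A QUADRATIC FACTOR.**  If `γ.charpoly = (X − λ)·(X² − tX + n)` then, with `N = γ − 1`, `μ = λ − 1`, `τ = t − 2`,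
`ν = n − t + 1` (so that `X² − tX + n = (X−1)² − τ(X−1) + ν`): `N³ = (μ + τ)•N² − (μτ + ν)•N + (μν)•1`.  (The quadratic factor need not split over `K`: the type-(2)
literals, whose `2 × 2` block has an irreducible characteristic polynomial.) [cite: Kottwitz1986, §3] [cite: Rogawski1990, §4.9 pp. 54–56] -/
theorem sub_one_pow_three_eq_of_charpoly_mul_quadratic {γm : Matrix (Fin 3) (Fin 3) K} {lam t n : K} (hchar : γm.charpoly = (X - C lam) * (X ^ 2 - C t * X + C n)) :
    (γm - 1) ^ 3 = (lam - 1 + (t - 2)) • (γm - 1) ^ 2 - ((lam - 1) * (t - 2) + (n - t + 1)) • (γm - 1) + ((lam - 1) * (n - t + 1)) • (1 : Matrix (Fin 3) (Fin 3) K) := by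
  -- the same cubic, re-centred at `X = 1` (commutative algebra in `K[X]`)
  have hp : (X - C lam) * (X ^ 2 - C t * X + C n) =
      (X - 1) ^ 3 - C (lam - 1 + (t - 2)) * (X - 1) ^ 2 + C ((lam - 1) * (t - 2) + (n - t + 1)) * (X - 1) - C ((lam - 1) * (n - t + 1)) := by
    simp only [map_add, map_sub, map_mul, map_one, map_ofNat]
    ring
  have hCH := Matrix.aeval_self_charpoly γm
  rw [hchar, hp] at hCH
  -- make the three scalar coefficients atomic before evaluating at `γ`
  generalize lam - 1 + (t - 2) = c₁ at hCH ⊢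
  generalize (lam - 1) * (t - 2) + (n - t + 1) = c₂ at hCH ⊢
  generalize (lam - 1) * (n - t + 1) = c₃ at hCH ⊢
  simp only [map_sub, map_add, map_mul, map_pow, aeval_X, aeval_C, map_one, Algebra.algebraMap_eq_smul_one, smul_one_mul] at hCH
  -- `hCH : N³ − c₁•N² + c₂•N − c₃•1 = 0`
  rw [← sub_eq_zero, ← hCH]
  abel

omit [Valued K ℤᵐ⁰] in
/-- The same identity for the conjugate `G⁻¹(γ − 1)G`. [cite: Kottwitz1986, §3] -/
theorem conj_sub_one_pow_three_eq_of_charpoly_mul_quadratic {γm : Matrix (Fin 3) (Fin 3) K} {lam t n : K} (hchar : γm.charpoly = (X - C lam) * (X ^ 2 - C t * X + C n))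
    {G : Matrix (Fin 3) (Fin 3) K} (hG : IsUnit G.det) :
    (G⁻¹ * (γm - 1) * G) ^ 3 = (lam - 1 + (t - 2)) • (G⁻¹ * (γm - 1) * G) ^ 2 - ((lam - 1) * (t - 2) + (n - t + 1)) • (G⁻¹ * (γm - 1) * G) +
      ((lam - 1) * (n - t + 1)) • (1 : Matrix (Fin 3) (Fin 3) K) := by
  rw [← inv_mul_pow_three_mul_eq_pow _ hG, ← inv_mul_sq_mul_eq_sq _ hG, sub_one_pow_three_eq_of_charpoly_mul_quadratic hchar, Matrix.mul_add, Matrix.add_mul, Matrix.mul_sub,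
    Matrix.sub_mul, Matrix.mul_smul, Matrix.smul_mul, Matrix.mul_smul, Matrix.smul_mul, Matrix.mul_smul, Matrix.smul_mul, Matrix.mul_one, Matrix.nonsing_inv_mul _ hG]

/-- **MATRIX LEVEL, type-(2) twin**: `γ.charpoly = (X − λ)(X² − tX + n)` with `|λ − 1|, |t − 2| ≤ |ϖ|^{d+1}` and `|n − t + 1| ≤ |ϖ|^{2d+2}` (the quadratic factor's roots are
`ϖ^{d+1}`-close to `1` in trace∕norm form), and `N′ = G⁻¹(γ − 1)G` `ϖ^d`-integral: then `|(N′³) i j| ≤ |ϖ|^{3d+1}`. [cite: Kottwitz1986, §3] [cite: Rogawski1990, §4.9 pp. 54–56] -/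
theorem v_conj_sub_one_pow_three_apply_le_of_charpoly_mul_quadratic {ϖ : K} (hϖ1 : Valued.v ϖ ≤ 1) {γm : Matrix (Fin 3) (Fin 3) K} {lam t n : K}
    (hchar : γm.charpoly = (X - C lam) * (X ^ 2 - C t * X + C n)) {d : ℕ}
    (hlam : Valued.v (lam - 1) ≤ Valued.v ϖ ^ (d + 1)) (ht : Valued.v (t - 2) ≤ Valued.v ϖ ^ (d + 1)) (hn : Valued.v (n - t + 1) ≤ Valued.v ϖ ^ (2 * d + 2))
    {G : Matrix (Fin 3) (Fin 3) K} (hG : IsUnit G.det) (hN : ∀ i j, Valued.v ((G⁻¹ * (γm - 1) * G) i j) ≤ Valued.v ϖ ^ d) (i j : Fin 3) :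
    Valued.v (((G⁻¹ * (γm - 1) * G) ^ 3 : Matrix (Fin 3) (Fin 3) K) i j) ≤ Valued.v ϖ ^ (3 * d + 1) := by
  have hpow : ∀ {m k : ℕ}, k ≤ m → Valued.v ϖ ^ m ≤ Valued.v ϖ ^ k := fun {m k} h => pow_le_pow_right_of_le_one' hϖ1 h
  set N' := G⁻¹ * (γm - 1) * G with hN'
  have hsq : ∀ i j, Valued.v ((N' ^ 2 : Matrix (Fin 3) (Fin 3) K) i j) ≤ Valued.v ϖ ^ d * Valued.v ϖ ^ d := fun i j => by
    rw [pow_two]; exact v_mul_apply_le_of_forall_v_le hN hN i j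
  have hμτ : Valued.v (lam - 1 + (t - 2)) ≤ Valued.v ϖ ^ (d + 1) := (Valuation.map_add _ _ _).trans (max_le hlam ht)
  have hc₂ : Valued.v ((lam - 1) * (t - 2) + (n - t + 1)) ≤ Valued.v ϖ ^ (2 * d + 2) := by
    refine (Valuation.map_add _ _ _).trans (max_le ?_ hn)
    rw [map_mul]
    calc Valued.v (lam - 1) * Valued.v (t - 2) ≤ Valued.v ϖ ^ (d + 1) * Valued.v ϖ ^ (d + 1) := mul_le_mul' hlam ht
      _ = Valued.v ϖ ^ (2 * d + 2) := by rw [← pow_add]; congr 1; ring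
  have hc₃ : Valued.v ((lam - 1) * (n - t + 1)) ≤ Valued.v ϖ ^ (3 * d + 3) := by
    rw [map_mul]
    calc Valued.v (lam - 1) * Valued.v (n - t + 1) ≤ Valued.v ϖ ^ (d + 1) * Valued.v ϖ ^ (2 * d + 2) := mul_le_mul' hlam hn
      _ = Valued.v ϖ ^ (3 * d + 3) := by rw [← pow_add]; congr 1; ring
  rw [conj_sub_one_pow_three_eq_of_charpoly_mul_quadratic hchar hG, Matrix.add_apply, Matrix.sub_apply, Matrix.smul_apply, Matrix.smul_apply, Matrix.smul_apply, smul_eq_mul,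
    smul_eq_mul, smul_eq_mul]
  refine (Valuation.map_add _ _ _).trans (max_le ((Valuation.map_sub _ _ _).trans (max_le ?_ ?_)) ?_)
  · rw [map_mul]
    calc Valued.v (lam - 1 + (t - 2)) * Valued.v ((N' ^ 2 : Matrix (Fin 3) (Fin 3) K) i j) ≤ Valued.v ϖ ^ (d + 1) * (Valued.v ϖ ^ d * Valued.v ϖ ^ d) :=
          mul_le_mul' hμτ (hsq i j)
      _ = Valued.v ϖ ^ (3 * d + 1) := by rw [← pow_add, ← pow_add]; congr 1; ring
  · rw [map_mul]
    calc Valued.v ((lam - 1) * (t - 2) + (n - t + 1)) * Valued.v (N' i j) ≤ Valued.v ϖ ^ (2 * d + 2) * Valued.v ϖ ^ d := mul_le_mul' hc₂ (hN i j)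
      _ = Valued.v ϖ ^ (3 * d + 2) := by rw [← pow_add]; congr 1; omega
      _ ≤ Valued.v ϖ ^ (3 * d + 1) := hpow (by omega)
  · rw [map_mul]
    calc Valued.v ((lam - 1) * (n - t + 1)) * Valued.v ((1 : Matrix (Fin 3) (Fin 3) K) i j) ≤ Valued.v ϖ ^ (3 * d + 3) * 1 :=
          mul_le_mul' hc₃ (by rw [Matrix.one_apply]; split_ifs <;> simp)
      _ ≤ Valued.v ϖ ^ (3 * d + 1) := by rw [mul_one]; exact hpow (by omega)

/-- **THE NILPOTENCY TOKEN, type-(2) twin.**  `γ.charpoly = (X − λ)(X² − tX + n)`, `|λ − 1|, |t − 2| ≤ |ϖ|^{d+1}`, `|n − t + 1| ≤ |ϖ|^{2d+2}` (`|ϖ| ≤ 1`, `ϖ ≠ 0`), and `γ − 1`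
of level `ϖ^d` on `latt g`: then `(γ − 1)³` has level `ϖ^{3d+1}` on `latt g` — the `hnil` of the rows C∕R∕E∕O∕P for a literal whose `2 × 2` block need not split over `K`.
[cite: Kottwitz1986, §3] [cite: Rogawski1990, §4.9 pp. 54–56] -/
theorem map_sub_one_pow_three_latt_le_scaleLattice_of_charpoly_mul_quadratic {ϖ : K} (hϖ1 : Valued.v ϖ ≤ 1) (hϖ0 : ϖ ≠ 0) {γm : Matrix (Fin 3) (Fin 3) K} {lam t n : K}
    (hchar : γm.charpoly = (X - C lam) * (X ^ 2 - C t * X + C n)) {d : ℕ}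
    (hlam : Valued.v (lam - 1) ≤ Valued.v ϖ ^ (d + 1)) (ht : Valued.v (t - 2) ≤ Valued.v ϖ ^ (d + 1)) (hn : Valued.v (n - t + 1) ≤ Valued.v ϖ ^ (2 * d + 2)) (g : GL (Fin 3) K)
    (hlev : (latt (g : Matrix (Fin 3) (Fin 3) K)).map ((Matrix.toLin' (γm - 1)).restrictScalars 𝒪[K]) ≤ scaleLattice (ϖ ^ d) (latt (g : Matrix (Fin 3) (Fin 3) K))) :
    (latt (g : Matrix (Fin 3) (Fin 3) K)).map ((Matrix.toLin' ((γm - 1) ^ 3)).restrictScalars 𝒪[K]) ≤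
      scaleLattice (ϖ ^ (3 * d + 1)) (latt (g : Matrix (Fin 3) (Fin 3) K)) := by
  have hG : IsUnit (g : Matrix (Fin 3) (Fin 3) K).det := Matrix.isUnits_det_units g
  have hN : ∀ i j, Valued.v (((g : Matrix (Fin 3) (Fin 3) K)⁻¹ * (γm - 1) * (g : Matrix (Fin 3) (Fin 3) K)) i j) ≤ Valued.v ϖ ^ d := by
    intro i j
    have h := (map_toLin'_latt_le_scaleLattice_iff (pow_ne_zero _ hϖ0) (γm - 1) hG).1 hlev i j
    rwa [map_pow] at h
  rw [map_toLin'_latt_le_scaleLattice_iff (pow_ne_zero _ hϖ0) _ hG, inv_mul_pow_three_mul_eq_pow _ hG]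
  intro i j
  rw [map_pow]
  exact v_conj_sub_one_pow_three_apply_le_of_charpoly_mul_quadratic hϖ1 hchar hlam ht hn hG hN i j

/-- The type-(2) twin at a VERTEX of any lattice graph (uniformiser token `|ϖ| = exp(−1)`). [cite: Kottwitz1986, §3] [cite: Rogawski1990, §4.9 pp. 54–56] -/
theorem map_sub_one_pow_three_le_scaleLattice_of_charpoly_mul_quadratic_of_isVertex {σ : K →+* K} {ϖ : K} (hϖ : Valued.v ϖ = WithZero.exp (-1 : ℤ))
    {H : Matrix (Fin 3) (Fin 3) K} {γm : Matrix (Fin 3) (Fin 3) K} {lam t n : K} (hchar : γm.charpoly = (X - C lam) * (X ^ 2 - C t * X + C n)) {d : ℕ}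
    (hlam : Valued.v (lam - 1) ≤ Valued.v ϖ ^ (d + 1)) (ht : Valued.v (t - 2) ≤ Valued.v ϖ ^ (d + 1)) (hn : Valued.v (n - t + 1) ≤ Valued.v ϖ ^ (2 * d + 2))
    {M : Submodule 𝒪[K] (Fin 3 → K)} (hM : IsVertex σ ϖ H M) (hlev : M.map ((Matrix.toLin' (γm - 1)).restrictScalars 𝒪[K]) ≤ scaleLattice (ϖ ^ d) M) :
    M.map ((Matrix.toLin' ((γm - 1) ^ 3)).restrictScalars 𝒪[K]) ≤ scaleLattice (ϖ ^ (3 * d + 1)) M := by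
  have hϖ0 : ϖ ≠ 0 := fun h0 => by rw [h0, map_zero] at hϖ; exact WithZero.coe_ne_zero hϖ.symm
  have hϖ1 : Valued.v ϖ ≤ 1 := by rw [hϖ, ← WithZero.exp_zero]; exact WithZero.exp_le_exp.2 (by norm_num)
  obtain ⟨_, g, rfl, -⟩ := hM
  exact map_sub_one_pow_three_latt_le_scaleLattice_of_charpoly_mul_quadratic hϖ1 hϖ0 hchar hlam ht hn g hlev

/-- **ROW-N FOR A LITERAL WITH A `2 × 2` BLOCK** (`γ ∈ U(J₀)`, socket dialect of `row_N`): `charpoly(γ) = (X − λ)·charpoly(B)` for some `B ∈ M₂(K)` with `|(B − 1) i j| ≤ |ϖ|^{d+1}`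
and `|λ − 1| ≤ |ϖ|^{d+1}`, and a vertex `w` with `LEV[w](ϖ^d)`: then `LEV₃[w](ϖ^(3d+1))` (`charpoly(B) = X² − tr B·X + det B`, `tr B − 2 = tr(B − 1)`, `det B − tr B + 1 = det(B − 1)`).
[cite: Kottwitz1986, §3] [cite: Rogawski1990, §4.9 pp. 54–56] -/
theorem map_sub_one_pow_three_le_scaleLattice_of_charpoly_block_antidiagonal {σ : K →+* K} {ϖ : K} (hϖ : Valued.v ϖ = WithZero.exp (-1 : ℤ))
    {γ : unitaryGroupOfForm σ ((StdForm.antidiagonal 3).over K)} {lam : K} {B : Matrix (Fin 2) (Fin 2) K}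
    (hchar : (((γ : GL (Fin 3) K) : Matrix (Fin 3) (Fin 3) K)).charpoly = (X - C lam) * B.charpoly)
    {d : ℕ} (hlam : Valued.v (lam - 1) ≤ Valued.v ϖ ^ (d + 1)) (hB : ∀ i j, Valued.v ((B - 1) i j) ≤ Valued.v ϖ ^ (d + 1))
    (w : {M : Submodule 𝒪[K] (Fin 3 → K) // IsVertex σ ϖ ((StdForm.antidiagonal 3).over K) M})
    (hlev : w.1.map ((Matrix.toLin' (((γ : GL (Fin 3) K) : Matrix (Fin 3) (Fin 3) K) - 1)).restrictScalars 𝒪[K]) ≤ scaleLattice (ϖ ^ d) w.1) :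
    w.1.map ((Matrix.toLin' ((((γ : GL (Fin 3) K) : Matrix (Fin 3) (Fin 3) K) - 1) ^ 3)).restrictScalars 𝒪[K]) ≤ scaleLattice (ϖ ^ (3 * d + 1)) w.1 := by
  rw [Matrix.charpoly_fin_two] at hchar
  have ht : Valued.v (B.trace - 2) ≤ Valued.v ϖ ^ (d + 1) := by
    rw [Matrix.trace_fin_two, show B 0 0 + B 1 1 - 2 = (B - 1) 0 0 + (B - 1) 1 1 by simp [Matrix.sub_apply]; ring]
    exact (Valuation.map_add _ _ _).trans (max_le (hB 0 0) (hB 1 1))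
  have hn : Valued.v (B.det - B.trace + 1) ≤ Valued.v ϖ ^ (2 * d + 2) := by
    rw [Matrix.det_fin_two, Matrix.trace_fin_two,
      show B 0 0 * B 1 1 - B 0 1 * B 1 0 - (B 0 0 + B 1 1) + 1 = (B - 1) 0 0 * (B - 1) 1 1 - (B - 1) 0 1 * (B - 1) 1 0 by simp [Matrix.sub_apply]; ring]
    refine (Valuation.map_sub _ _ _).trans (max_le ?_ ?_)
    · rw [map_mul]
      calc Valued.v ((B - 1) 0 0) * Valued.v ((B - 1) 1 1) ≤ Valued.v ϖ ^ (d + 1) * Valued.v ϖ ^ (d + 1) := mul_le_mul' (hB 0 0) (hB 1 1)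
        _ = Valued.v ϖ ^ (2 * d + 2) := by rw [← pow_add]; congr 1; ring
    · rw [map_mul]
      calc Valued.v ((B - 1) 0 1) * Valued.v ((B - 1) 1 0) ≤ Valued.v ϖ ^ (d + 1) * Valued.v ϖ ^ (d + 1) := mul_le_mul' (hB 0 1) (hB 1 0)
        _ = Valued.v ϖ ^ (2 * d + 2) := by rw [← pow_add]; congr 1; ring
  exact map_sub_one_pow_three_le_scaleLattice_of_charpoly_mul_quadratic_of_isVertex hϖ hchar hlam ht hn w.2 hlev

end Literature.NumberTheory.Automorphic.UnitaryLatticeTree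

end
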